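import Summits.RiemannHypothesis.RiemannHypothesis.Theorems.MotivicDoorCertPosGramPacked
import Summits.RiemannHypothesis.RiemannHypothesis.Theorems.MotivicDoorCertPosX13N100OddPart1
import Summits.RiemannHypothesis.RiemannHypothesis.Theorems.MotivicDoorCertPosX13N100OddDataC0a
import Summits.RiemannHypothesis.RiemannHypothesis.Theorems.MotivicDoorCertPosX13N100OddDataC0b
import Summits.RiemannHypothesis.RiemannHypothesis.Theorems.MotivicDoorCertPosX13N100OddDataC1a
import Summits.RiemannHypothesis.RiemannHypothesis.Theorems.MotivicDoorCertPosX13N100OddDataC1b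
import Summits.RiemannHypothesis.RiemannHypothesis.Theorems.MotivicDoorCertPosX13N100OddDataC2a
import Summits.RiemannHypothesis.RiemannHypothesis.Theorems.MotivicDoorCertPosX13N100OddDataC2b
import Summits.RiemannHypothesis.RiemannHypothesis.Theorems.MotivicDoorCertPosX13N100OddDataC3
import Summits.RiemannHypothesis.RiemannHypothesis.Theorems.MotivicDoorCertPosX13N100OddDataL0a
import Summits.RiemannHypothesis.RiemannHypothesis.Theorems.MotivicDoorCertPosX13N100OddDataL0b
import Summits.RiemannHypothesis.RiemannHypothesis.Theorems.MotivicDoorCertPosX13N100OddDataL1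
import Summits.RiemannHypothesis.RiemannHypothesis.Theorems.MotivicDoorCertPosGramUpperRows
import Summits.RiemannHypothesis.RiemannHypothesis.Theorems.PfPersistenceWeilParityPair
import HarnessLib

/-!
# Motivic door / CERTPOS cell `x13N100Odd` — certified `ε₁` enclosure of a truncated Weil-form block — PART 2 (row shards 6–7)

pub-rhdoor (MOTIVIC-DOOR ticket), unit `certpos`; schema `rhdoor.certpos/1`. HONEST FRAMING: lottery ticket at the motivic
door; RH probability negligible; this file is a DATA-conditioned certificate about ONE finite window matrix — no RH claim,
no claim about `N → ∞` or about other windows.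

CELL: a = log 13 / 2 (L = 2a = log 13, the x = 13 window of [CCM2025]/[Connes2026]); S = all places (the zeta weights Λ(q) q^{-1/2} on every prime power q ≤ e^L); odd sector, test space V_N^- of dimension N = 100 (PfPersistence.oddBlock).

* DATA (hypothesis `hG : x13N100Odd.Encloses G`, NOT proved here): every entry of the tree matrix `G = oddBlock zetaWeights x13N100OddWin` lies in the ball
  `C i j / 2^220 ± r i j / 2^220` of the certificate. Produced off-line by TWO independent interval engines whose entrywise balls
  overlap (max hull width 1.9833566456403087e-119, max midpoint difference 1.2244516565383818e-127; the Lean data is the hull re-rounded outward to scale 2^220):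
  * eng1_arb/wa_core (python-flint Arb), 432 bits, wa_core sha256 661b62ee9ab2476f…
  * eng2_iv/EM-digamma (mpmath.iv mpmath.ctx_mp), 432 bits
  Source certificate digest (sha256 over k,t,u,mn,bn,Cn,rn,Ln): `6e433c1dfae224da526612f3bb52aff89a33da50533ba5a1c2bb53299ee9c45a`; re-rounded digest `30d2366662cbe8c60feca124d776fc86d941c351c90d727f0c3a77c1aeb63849`.
* PROVED (kernel, `decide +kernel`, 10 row shards): the integer check `GramCert.Valid` (LDLᵀ residual budget) and the
  upper witness check `GramCert.upperOK`; hence, GIVEN the data hypothesis,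
  `margin ≤ ε₁(G) ≤ num/den` with  margin = 3.34107741853630002727556006041e-55  and  num/den = 3.34107742034439009780875916118e-55
  (relative gap 5.41e-10). In particular `0 < ε₁(G)`: the block is POSITIVE DEFINITE (given the data).
-/

set_option linter.dupNamespace false
set_option exponentiation.threshold 4096

namespace Summit.RiemannHypothesis.RiemannHypothesis.Theorems.MotivicDoor.CertPos

open Summit.RiemannHypothesis.RiemannHypothesis.Theorems.PfPersistence

set_option maxHeartbeats 0 in
/-- PROVED (kernel): row shard 6 (rows 60 ≤ i < 70) of the check passes. [folklore] -/
theorem x13N100Odd_rows_6 : x13N100Odd.rowsOK (10 * 6) 10 = true := by decide +kernel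

set_option maxHeartbeats 0 in
/-- PROVED (kernel): row shard 7 (rows 70 ≤ i < 80) of the check passes. [folklore] -/
theorem x13N100Odd_rows_7 : x13N100Odd.rowsOK (10 * 7) 10 = true := by decide +kernel

end Summit.RiemannHypothesis.RiemannHypothesis.Theorems.MotivicDoor.CertPos

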